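import Literature.Analysis.FluidPDE.NSBoundedMildOseen
import HarnessLib

/-!
# Albritton–Barker's Liouville theorem for ancient mild solutions bounded in `L³` along backward times

Trunk T-FLUID (`Literature/Analysis/FluidPDE`), problem `NavierStokesRegularity`, route
`PlaneEnergyCeiling` (D-0016). Filed while grounding the crux
`Summit.NavierStokesRegularity.NavierStokesRegularity.Theses.PlaneEnergyCeiling.PlanarEnergyLiouville`
(item `stmt-NavierStokesRegularity-16856`): "a bounded ancient mild solution of Navier–Stokes
(`ν = 1`) on `ℝ³ × (−∞, 0)`, jointly smooth, whose planar kinetic energies `∫_Π |v(t)|² dA` are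
bounded uniformly over all planes `Π` and all `t < 0`, is identically zero". The nearest Liouville
theorem **in print** for ancient mild solutions under a hypothesis on a *critical, time-uniform*
quantity of the velocity is Albritton–Barker's (J. Math. Fluid Mech. 21 (2019), Paper 43 =
arXiv:1811.00502, **Theorem 1.2**): "If `v` is a mild ancient solution satisfying
`sup_{k ∈ ℕ} ‖v(·, t_k)‖_{L³} < ∞` for a sequence of times `t_k ↓ −∞`, then `v ≡ 0`." (proved in
§4 from the quantitative `L^{3,∞}` version, Theorem 4.1, by zooming out and the persistence of
singularities). It is vendored here as the named fact
`Literature.Analysis.FluidPDE.AlbrittonBarker2019_liouville_L3_backward`.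

The item `PlaneEnergyCeiling.PlanarEnergyLiouville` is **not** an instance: a bounded field with
uniformly bounded planar energies need not have a single slice in `L³` (or in `L^{3,∞}`, or in
`Ḃ^{-1+3/p}_{p,∞}`, `p < ∞`): unit bumps centred at the points `(j, j², j³)`, `j ∈ ℕ`, of the
moment curve have planar energies bounded uniformly over all planes (a plane passes within
distance `1` of boundedly many of the centres) but infinite `L³` norm. The fact grounds only the
"finite-energy / `L³` corner" of the crux named in the route thesis; the crux itself is recorded as
new relative to print (grounder note on the item).

## Rendering choices

* **The class.** Albritton–Barker's "mild (bounded) ancient solutions" are "solutions which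
  satisfy the integral equation formulation of the Navier–Stokes equations and are bounded (in
  fact, smooth) for all backward times" (§1, after [KNSS]); §4 (footnote) relaxes bounded to
  `L^∞_{t,loc} L^∞_x(ℝ³ × ]−∞, 0[)`. The fact is stated over the tree's rendering of exactly this
  integral-equation class at `ν = 1`, the one produced by `KNSS2009_lemma61_oseenMild`
  (`AncientMildCompactness.lean`) and consumed by `isBoundedAncientMildSolution_of_oseen`
  (`KNSSTypeIRateLiouvilleMild.lean`): a field `v : ℝ → ℝ³ → ℝ³` continuous on the open slab
  `(−∞, 0) × ℝ³`, bounded there (the bounded sub-class: a special case of the printed hypothesis),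
  with weakly divergence-free slices, satisfying the Oseen integral identity
  `v(t) = e^{(t−s)Δ} v(s) − B¹_s(v, v)(t)` pointwise for all `s < t < 0`
  (`UnboundedOperators.heatExtension`, `oseenDuhamel`). It is deliberately **not** stated over the
  duality-form class `IsBoundedAncientMildSolution 1 v` (`SelfSimilar.lean`): that class does not
  see a spatially constant drift `b(t)` (cf. the docstring of `LiouvilleConjectureNS`), and the
  drift `v(t, x) = b(t)` with `b(t_k) = 0`, `b ≢ 0` would falsify the transcription.
* `sup_k ‖v(·, t_k)‖_{L³} < ∞` along `t_k ↓ −∞`: a sequence `τ : ℕ → ℝ` of negative times with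
  `τ_k → −∞` (`Tendsto τ atTop atBot`; monotonicity of the printed `t_k ↓ −∞` is not used and is
  dropped — any sequence tending to `−∞` has a decreasing subsequence) and a finite `M : ℝ≥0∞` with
  `eLpNorm (v (τ k)) 3 volume ≤ M` (the slices are continuous, so this is the printed `L³` norm).
* "`v ≡ 0`": `v t x = 0` for all `t < 0` and all `x` (the field is continuous on the open slab).

## References

* D. Albritton, T. Barker, *On local Type I singularities of the Navier–Stokes equations and
  Liouville theorems*, J. Math. Fluid Mech. 21 (2019), Paper No. 43 = arXiv:1811.00502: §1,
  Theorem 1.2 (arXiv p. 4) and §4, Theorem 4.1 with its proof (arXiv p. 9). [AlbrittonBarker2019]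
* G. Koch, N. Nadirashvili, G. Seregin, V. Šverák, *Liouville theorems for the Navier–Stokes
  equations and applications*, Acta Math. 203 (2009) = arXiv:0709.3599, §1 and §4 (i) (bounded
  mild ancient solutions, the integral equation). [KochNadirashviliSereginSverak2009]
-/

noncomputable section

open MeasureTheory Set Function Filter Topology
open scoped NNReal ENNReal

namespace Literature.Analysis.FluidPDE

/-- Local notation for physical space `ℝ³ = EuclideanSpace ℝ (Fin 3)`. -/
local notation "ℝ³" => EuclideanSpace ℝ (Fin 3)

/-- **Albritton–Barker 2019, Theorem 1.2** (Liouville theorem for ancient mild solutions bounded in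
`L³` along a backward sequence of times; J. Math. Fluid Mech. 21 (2019) = arXiv:1811.00502, Thm. 1.2:
"If `v` is a mild ancient solution satisfying `sup_{k∈ℕ} ‖v(·,t_k)‖_{L³} < ∞` for a sequence of
times `t_k ↓ −∞`, then `v ≡ 0`."). For every field `v : ℝ → ℝ³ → ℝ³` which is a bounded ancient
mild solution of Navier–Stokes (`ν = 1`) in the integral-equation sense of KNSS 2009, §4 (i) —
continuous on `(−∞, 0) × ℝ³`, bounded there, weakly divergence-free slices, and
`v(t) = e^{(t−s)Δ}v(s) − B¹_s(v, v)(t)` pointwise for all `s < t < 0` — and for which there are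
negative times `τ_k → −∞` and a finite `M` with `‖v(τ_k)‖_{L³} ≤ M` for all `k`, one has
`v(t, x) = 0` for all `t < 0` and all `x`. Filed while grounding
`Summit.NavierStokesRegularity.NavierStokesRegularity.Theses.PlaneEnergyCeiling.PlanarEnergyLiouville`
(its `L³` corner only; the planar-energy class of that crux is not contained in `L³`, module
docstring). [cite: AlbrittonBarker2019, Thm 1.2 (arXiv:1811.00502 p. 4; proof §4 p. 9 via Thm 4.1)] -/
def AlbrittonBarker2019_liouville_L3_backward : Prop :=
  ∀ ⦃v : ℝ → ℝ³ → ℝ³⦄, ContinuousOn (uncurry v) (Iio 0 ×ˢ univ) →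
    (∃ K : ℝ, ∀ t < 0, ∀ x, ‖v t x‖ ≤ K) →
    (∀ t < 0, IsWeaklyDivFree (v t)) →
    (∀ s t : ℝ, s < t → t < 0 → ∀ x,
      v t x = UnboundedOperators.heatExtension (v s) (t - s) x - oseenDuhamel 1 s v v t x) →
    (∃ (τ : ℕ → ℝ) (M : ℝ≥0∞), M < ∞ ∧ Tendsto τ atTop atBot ∧ (∀ k, τ k < 0) ∧
      ∀ k, eLpNorm (v (τ k)) 3 volume ≤ M) →
    ∀ t < 0, ∀ x, v t x = 0

/-! ### Theorem 4.1: the quantitative `L^{3,∞}` generalisation (special case `ε = 0`)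

Filed by the lead prover of the crux
`Summit.NavierStokesRegularity.NavierStokesRegularity.Theses.HardyPointSink.NoHardyTypeIAncient`
(item `stmt-NavierStokesRegularity-7980`, line `birth`): the Hardy bound of that crux puts every
slice in the class `𝔹` below, so the Liouville half of the line needs Theorem 4.1 rather than
Theorem 1.2. Rendering choices beyond those of `AlbrittonBarker2019_liouville_L3_backward`:

* `‖v(·, t_k)‖_{L^{3,∞}} ≤ M`: the weak-`L³` quasi-norm through the distribution function,
  `s³ · |{x : s < |v(t_k, x)|}| ≤ M` for all `s > 0` (equivalent to the Lorentz quasi-norm bound up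
  to the universal constant of the quasi-norm; no `L^{3,∞}` space is needed);
* the class `𝔹` (§4, display before Thm 4.1: "Let `𝔹` denote the subspace of `Ḃ^{-1}_{∞,∞}` whose
  functions `f` satisfy `f(λ·) → 0` in the sense of distributions as `λ → ∞`"): membership of the
  final slice `g = v(t₀)` is rendered by the two clauses (a) `sup_{σ > 0} √σ ‖e^{σΔ} g‖_∞ < ∞`, the
  heat-kernel form of `g ∈ Ḃ^{-1}_{∞,∞}` (for bounded `g` equivalent to the Littlewood–Paley norm,
  Bahouri–Chemin–Danchin 2011, Thm 2.34), and (b) `∫ ⟪λ g(λx), φ(x)⟫ dx → 0` as `λ → ∞` for every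
  smooth compactly supported field `φ` — the Navier–Stokes rescaling `λ g(λ ·)`, which is the one the
  proof uses ("`U^{(k)}` … correspond to `U` …, appropriately rescaled", with
  `v^{(k)}(x, t) = √|t_k| v(√|t_k| x, |t_k| t)`) and is a stronger requirement than the literal
  `g(λ ·) → 0`, so the rendered fact is implied by the printed one either way;
* only the case `ε = 0` (`dist(v(·, 0), 𝔹) = 0`, i.e. `v(·, 0) ∈ 𝔹`) is stated, and the final time
  is an arbitrary `t₀ < 0` of the open slab (apply the printed theorem to the time translate
  `w(·, t) = v(·, t + t₀)`, an ancient mild solution on `]−∞, −t₀[ ⊋ ]−∞, 0]` with the honest slice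
  `w(·, 0) = v(·, t₀)` and `‖w(·, t_k − t₀)‖_{L^{3,∞}} ≤ M` along `t_k − t₀ ↓ −∞`); the conclusion
  `v ≡ 0` of the printed theorem for `w` is `v(t, x) = 0` for all `t ≤ t₀`;
* `t_k ↓ −∞` is any sequence of negative times tending to `−∞` (a decreasing subsequence exists).
-/

open scoped RealInnerProductSpace in
/-- **Albritton–Barker 2019, Theorem 4.1** (Liouville theorem in `L^{3,∞}` along a backward sequence;
J. Math. Fluid Mech. 21 (2019) no. 43 = arXiv:1811.00502, §4 p. 9: "For all `M > 0`, there exists a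
constant `ε = ε(M) > 0` satisfying the following property. Suppose that `v` is a mild ancient
solution [footnote: in the class `L^∞_{t,loc} L^∞_x(ℝ³ × ]−∞,0[)`] such that
`‖v(·,t_k)‖_{L^{3,∞}} ≤ M` (4.2) for a sequence `t_k ↓ −∞`. If `dist_{Ḃ^{-1}_{∞,∞}}(v(·,0), 𝔹) ≤ ε`
(4.3), then `limsup_{k→∞} √(|t_k|/2) ‖v‖_{L^∞(Q(√(|t_k|/2)))} < ∞` (4.4). Hence, `v ≡ 0`."; proved
from the theory of weak `L^{3,∞}` solutions of Barker–Seregin–Šverák and the backward-uniqueness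
Proposition 4.2), **special case `ε = 0` with final time `t₀ < 0`**, over the bounded Oseen
integral-equation class of KNSS 2009 §4 (i) as in `AlbrittonBarker2019_liouville_L3_backward`. For
every `v : ℝ → ℝ³ → ℝ³` continuous and bounded on `(−∞, 0) × ℝ³`, with weakly divergence-free
slices and `v(t) = e^{(t−s)Δ}v(s) − B¹_s(v, v)(t)` pointwise for all `s < t < 0`; if there are
negative times `τ_k → −∞` and a finite `M` with `s³ · vol{x : s < |v(τ_k, x)|} ≤ M` for all `s > 0`
and all `k` (uniform weak-`L³` bound), and at some `t₀ < 0` the slice `v(t₀)` lies in `𝔹` —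
`√σ ‖e^{σΔ}v(t₀)‖_∞ ≤ A` for all `σ > 0`, and `∫ ⟪λ v(t₀)(λx), φ(x)⟫ dx → 0` as `λ → ∞` for every
smooth compactly supported `φ : ℝ³ → ℝ³` — then `v(t, x) = 0` for all `t ≤ t₀` and all `x`
(rendering notes in the section docstring). -- TODO(general form): the `ε(M)`-neighbourhood of `𝔹`
in `Ḃ^{-1}_{∞,∞}` (needs a Besov distance on slices). [cite: AlbrittonBarker2019, Thm 4.1 (arXiv:1811.00502 §4 p. 9), with Prop. 4.2 and the definition of 𝔹] -/
def AlbrittonBarker2019_liouville_weakL3_backward : Prop :=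
  ∀ ⦃v : ℝ → ℝ³ → ℝ³⦄, ContinuousOn (uncurry v) (Iio 0 ×ˢ univ) →
    (∃ C : ℝ, ∀ t < 0, ∀ x, ‖v t x‖ ≤ C) →
    (∀ t < 0, IsWeaklyDivFree (v t)) →
    (∀ s t : ℝ, s < t → t < 0 → ∀ x,
      v t x = UnboundedOperators.heatExtension (v s) (t - s) x - oseenDuhamel 1 s v v t x) →
    (∃ (τ : ℕ → ℝ) (M : ℝ≥0∞), M < ∞ ∧ Tendsto τ atTop atBot ∧ (∀ k, τ k < 0) ∧
      ∀ (k : ℕ) (s : ℝ), 0 < s → ENNReal.ofReal s ^ 3 * volume {x : ℝ³ | s < ‖v (τ k) x‖} ≤ M) →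
    ∀ ⦃t₀ : ℝ⦄, t₀ < 0 →
    (∃ A : ℝ, ∀ σ : ℝ, 0 < σ → ∀ x,
      Real.sqrt σ * ‖UnboundedOperators.heatExtension (v t₀) σ x‖ ≤ A) →
    (∀ φ : ℝ³ → ℝ³, FunctionSpaces.IsTestFunctionOn (⊤ : TopologicalSpace.Opens ℝ³) φ →
      Tendsto (fun lam : ℝ => ∫ x, ⟪lam • v t₀ (lam • x), φ x⟫) atTop (𝓝 0)) →
    ∀ t : ℝ, t ≤ t₀ → ∀ x, v t x = 0

end Literature.Analysis.FluidPDE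

end
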